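import Mathlib
import Summits.MatrixMultiplication.Statement
import Literature.RingTheory.KrullDimension.HomogeneousCommonZero
import Summits.MatrixMultiplication.MatrixMultiplication.Theorems.GraphEquationsCubicDictionaryConverse

/-!
# GraphEquations — every correct verification system has at least `n²` tests and cost `≥ n²`;
the verification exponent is `≥ 2` (M48; cell `decomp-mm`, lens-5 g40)

Helper kernel beneath the attacked crux `MultiplicityReduction` (stmt-MatrixMultiplication-27806) of
route `GraphEquations`.  DEGREE-FREE, UNCONDITIONAL facts about ARBITRARY correct equation systems
`E` for the graph `W_n` (reduced or not — no `H_mult` hypothesis):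

* `EqSystem.Correct.sq_le_card_testFinset` — a correct system has at least `n²` distinct non-zero test
  polynomials; hence `sq_le_length` (`n² ≤ #tests`) and **`sq_le_cost` (`n² ≤ cost`)**;
* **`two_le_of_eqAdmissible` — `EqAdmissible β → 2 ≤ β`**: the verification exponent is at least
  `2`, exactly like `ω ≥ 2`;
* `AffSystem.Correct.sq_le_m` — a correct AFFINE system has `m ≥ n²` tests (so in the rung-3
  model kernels never come from a count: `dim K(A,B) ≥ N − m` is vacuous).  Tight: the `n²`
  coordinate tests `c_q − (AB)_q` are affine, correct and reduced.

Proof: restrict the tests to the SLICE `A = B = 0` (`sliceHom`: `a, b ↦ 0`, `c_q ↦ X_q`).  The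
restricted tests are `< n²` polynomials in `n²` variables without constant term (they vanish at
the graph point `0`), so by the affine dimension theorem at the origin
(`Literature.RingTheory.KrullDimension.exists_ne_zero_common_zero_of_card_lt`: Krull's height
theorem + Nullstellensatz, `ℂ` algebraically closed) they have a common zero `δ ≠ 0`; then
`(0, 0, δ)` passes every test but `δ ≠ 0·0`, contradicting correctness.

Sorry-free; no stub credit claimed.
-/

set_option linter.dupNamespace false
set_option linter.unusedSectionVars false

noncomputable section

namespace Summit.MatrixMultiplication.MatrixMultiplication.Theorems.GraphEquations

open MvPolynomial Matrix Literature.Computability.AlgebraicComplexity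
open Literature.Computability.AlgebraicComplexity.ArithCircuit

variable {n : ℕ}

/-! ## The slice `A = B = 0` -/

/-- Index pairs as `Fin (n·n)`. -/
def flat (n : ℕ) : Fin n × Fin n ≃ Fin (n * n) := finProdFinEquiv

/-- The substitution `a, b ↦ 0`, `c_q ↦ X_{flat q}`. -/
def sliceMap (n : ℕ) : GraphVars n → MvPolynomial (Fin (n * n)) ℂ :=
  Sum.elim (fun _ => 0) (fun q => X (flat n q))

/-- Restriction of a polynomial on `ℂ^{3N}` to the slice `{(0, 0, c)}`, as a polynomial in `N = n²`
variables. -/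
def sliceHom (n : ℕ) : MvPolynomial (GraphVars n) ℂ →ₐ[ℂ] MvPolynomial (Fin (n * n)) ℂ :=
  bind₁ (sliceMap n)

/-- A point of `ℂ^{n·n}` read as a `c`-block. -/
def unflat (x : Fin (n * n) → ℂ) : Vec n := fun q => x (flat n q)

/-- `unflat x = 0 ↔ x = 0`. -/
theorem unflat_eq_zero_iff (x : Fin (n * n) → ℂ) : unflat x = 0 ↔ x = 0 := by
  constructor
  · intro h
    funext j
    have hj := congrFun h ((flat n).symm j)
    simpa [unflat] using hj
  · rintro rfl
    rfl

/-- Evaluating the slice of `p` at `x` is evaluating `p` at the point `(0, 0, unflat x)`. -/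
theorem eval_sliceHom (x : Fin (n * n) → ℂ) (p : MvPolynomial (GraphVars n) ℂ) :
    eval x (sliceHom n p) = eval (pt 0 0 (unflat x)) p := by
  have hg : (fun i => eval₂Hom (RingHom.id ℂ) x (sliceMap n i)) = pt 0 0 (unflat x) := by
    funext i
    rcases i with (v | t) | q <;> simp [sliceMap, pt, unflat]
  show eval₂Hom (RingHom.id ℂ) x (bind₁ (sliceMap n) p) = _
  rw [eval₂Hom_bind₁, hg]
  rfl

/-- The constant term of the slice of `p` is `p(0, 0, 0)`. -/
theorem constantCoeff_sliceHom (p : MvPolynomial (GraphVars n) ℂ) :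
    constantCoeff (sliceHom n p) = eval (pt 0 0 0) p := by
  rw [← eval_zero, eval_sliceHom]
  rfl

/-! ## Test count and cost of a correct system -/

open scoped Classical

namespace EqSystem

variable {E : EqSystem n}

/-- The distinct non-zero test polynomials of `E`. -/
def testFinset (E : EqSystem n) : Finset (MvPolynomial (GraphVars n) ℂ) :=
  ((E.tests.map E.testPoly).toFinset).erase 0

/-- Membership in `testFinset`. -/
theorem mem_testFinset {p : MvPolynomial (GraphVars n) ℂ} :
    p ∈ E.testFinset ↔ p ≠ 0 ∧ ∃ j ∈ E.tests, E.testPoly j = p := by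
  rw [testFinset, Finset.mem_erase, List.mem_toFinset, List.mem_map]

/-- A point at which every member of `testFinset` vanishes lies in the zero set. -/
theorem mem_zeroSet_of_testFinset {x : GraphVars n → ℂ} (h : ∀ p ∈ E.testFinset, eval x p = 0) :
    x ∈ E.zeroSet := by
  intro j hj
  by_cases hp : E.testPoly j = 0
  · rw [hp, map_zero]
  · exact h _ (mem_testFinset.mpr ⟨hp, j, hj, rfl⟩)

/-- **A correct system has at least `n²` distinct non-zero tests** (affine dimension theorem on the
slice `A = B = 0`). -/
theorem Correct.sq_le_card_testFinset (hE : E.Correct) : n * n ≤ E.testFinset.card := by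
  classical
  by_contra hlt
  push Not at hlt
  set s := E.testFinset.image (sliceHom n) with hs_def
  have hs : s.card < n * n := Finset.card_image_le.trans_lt hlt
  have h0 : ∀ p ∈ s, constantCoeff p = 0 := by
    intro p hp
    obtain ⟨p', hp', rfl⟩ := Finset.mem_image.mp hp
    obtain ⟨-, j, hj, rfl⟩ := mem_testFinset.mp hp'
    rw [constantCoeff_sliceHom]
    exact hE.eval_testPoly_eq_zero ((pt_mem_mmGraph_iff 0 0 0).mpr (prodVec_zero_left 0).symm) hj
  obtain ⟨x, hx0, hx⟩ :=
    Literature.RingTheory.KrullDimension.exists_ne_zero_common_zero_of_card_lt s h0 hs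
  have hmem : pt 0 0 (unflat x) ∈ E.zeroSet := mem_zeroSet_of_testFinset fun p hp => by
    rw [← eval_sliceHom]
    exact hx _ (Finset.mem_image_of_mem _ hp)
  rw [hE.2, pt_mem_mmGraph_iff, prodVec_zero_left] at hmem
  exact hx0 ((unflat_eq_zero_iff x).mp hmem)

/-- `#testFinset ≤ #tests`. -/
theorem testFinset_card_le_length : E.testFinset.card ≤ E.tests.length :=
  calc E.testFinset.card ≤ (E.tests.map E.testPoly).toFinset.card := Finset.card_erase_le
    _ ≤ (E.tests.map E.testPoly).length := List.toFinset_card_le _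
    _ = E.tests.length := by simp

/-- `#testFinset ≤ cost`: a non-zero test is the value of an actual gate. -/
theorem testFinset_card_le_cost : E.testFinset.card ≤ E.cost := by
  classical
  have hsub : E.testFinset ⊆ (Finset.univ : Finset (Fin (gateValues E.circuit.gates).length)).image
      (fun i => (gateValues E.circuit.gates).get i) := by
    intro p hp
    obtain ⟨hp0, j, hj, rfl⟩ := mem_testFinset.mp hp
    have hjl : j < (gateValues E.circuit.gates).length := by
      by_contra hle
      exact hp0 (by
        simp only [testPoly]
        exact List.getD_eq_default _ _ (le_of_not_gt hle))
    refine Finset.mem_image.mpr ⟨⟨j, hjl⟩, Finset.mem_univ _, ?_⟩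
    simp only [testPoly, List.get_eq_getElem]
    exact (List.getD_eq_getElem _ _ hjl).symm
  calc E.testFinset.card ≤ _ := Finset.card_le_card hsub
    _ ≤ (Finset.univ : Finset (Fin (gateValues E.circuit.gates).length)).card :=
        Finset.card_image_le
    _ = E.cost := by
        rw [Finset.card_univ, Fintype.card_fin, gateValues_length]
        rfl

/-- **`n² ≤ #tests`** for a correct system. -/
theorem Correct.sq_le_length (hE : E.Correct) : n * n ≤ E.tests.length :=
  hE.sq_le_card_testFinset.trans testFinset_card_le_length

/-- **`n² ≤ cost`** for a correct system (degree-free, unconditional). -/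
theorem Correct.sq_le_cost (hE : E.Correct) : n * n ≤ E.cost :=
  hE.sq_le_card_testFinset.trans testFinset_card_le_cost

end EqSystem

/-! ## The verification exponent is at least `2` -/

/-- **`EqAdmissible β → 2 ≤ β`.**  Correct systems of cost `O(n^β)` for all `n` force `β ≥ 2`,
since each has cost `≥ n²`. -/
theorem two_le_of_eqAdmissible {β : ℝ} (h : EqAdmissible β) : 2 ≤ β := by
  by_contra hβ
  push Not at hβ
  obtain ⟨c, hc⟩ := h
  set γ : ℝ := 2 - β with hγ_def
  have hγ : 0 < γ := by rw [hγ_def]; linarith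
  have hev : ∀ᶠ m : ℕ in Filter.atTop, c + 1 ≤ ((m : ℝ)) ^ γ :=
    ((tendsto_rpow_atTop hγ).comp tendsto_natCast_atTop_atTop).eventually_ge_atTop (c + 1)
  obtain ⟨m, hmc, hm1⟩ := (hev.and (Filter.eventually_ge_atTop 1)).exists
  obtain ⟨E, hE, hcost⟩ := hc m hm1
  have hm : (0 : ℝ) < m := by exact_mod_cast hm1
  have hsq : ((m : ℝ)) ^ (2 : ℝ) ≤ c * (m : ℝ) ^ β := by
    have h2 : ((m : ℝ)) * m ≤ (E.cost : ℝ) := by exact_mod_cast hE.sq_le_cost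
    rw [Real.rpow_two, sq]
    exact h2.trans hcost
  have hsplit : ((m : ℝ)) ^ (2 : ℝ) = (m : ℝ) ^ β * (m : ℝ) ^ γ := by
    rw [← Real.rpow_add hm, hγ_def]
    ring_nf
  rw [hsplit, mul_comm c] at hsq
  have hγc : ((m : ℝ)) ^ γ ≤ c := le_of_mul_le_mul_left hsq (Real.rpow_pos_of_pos hm β)
  linarith

/-! ## Affine systems need `n²` tests; the coordinate tests are tight -/

namespace AffSystem

variable {S : AffSystem n}

/-- **A correct affine system has `m ≥ n²` tests** (through the realising equation system of M44
and `EqSystem.Correct.sq_le_card_testFinset`). -/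
theorem Correct.sq_le_m (hC : S.Correct) : n * n ≤ S.m := by
  classical
  obtain ⟨E, hfan, hto, hfrom⟩ := exists_eqSystem_of_affSystem S
  have hE : E.Correct := correct_of_realises hC hfan hto hfrom
  have hsub : E.testFinset ⊆ (Finset.univ : Finset (Fin S.m)).image fun o => (S.test o).poly := by
    intro p hp
    obtain ⟨-, j, hj, rfl⟩ := EqSystem.mem_testFinset.mp hp
    obtain ⟨o, ho⟩ := hto j hj
    exact Finset.mem_image.mpr ⟨o, Finset.mem_univ _, ho.symm⟩
  calc n * n ≤ E.testFinset.card := hE.sq_le_card_testFinset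
    _ ≤ _ := Finset.card_le_card hsub
    _ ≤ (Finset.univ : Finset (Fin S.m)).card := Finset.card_image_le
    _ = S.m := by rw [Finset.card_univ, Fintype.card_fin]

/-- Equivalently: no correct affine system has fewer than `n²` tests — AQRₙ concerns `m ≥ n²` only. -/
theorem Correct.not_m_lt (hC : S.Correct) : ¬ S.m < n * n := _root_.not_lt.mpr hC.sq_le_m

end AffSystem

/-- The coordinate test `c_q − (AB)_q`: `κ = e_q`, no linear or `C`-part. -/
def coordTest (q : Fin n × Fin n) : AffTest n := ⟨Pi.single q 1, 0, 0, 0⟩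

/-- The coordinate test evaluates to `(C − AB)_q`. -/
theorem coordTest_eval (q : Fin n × Fin n) (A B C : Vec n) :
    (coordTest q).eval A B C = (C - prodVec A B) q := by
  simp [coordTest, AffTest.eval, AffTest.coef]

/-- The coordinate system: the `n²` tests `c_q − (AB)_q`. -/
def coordSystem (n : ℕ) : AffSystem n := ⟨n * n, fun j => coordTest ((flat n).symm j)⟩

/-- The coordinate system is correct. -/
theorem coordSystem_correct : (coordSystem n).Correct := by
  intro A B C h
  have h' : C - prodVec A B = 0 := by
    funext q
    have hq := h (flat n q)
    simp only [coordSystem, Equiv.symm_apply_apply, coordTest_eval] at hq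
    exact hq
  exact sub_eq_zero.mp h'

/-- The coordinate system is reduced everywhere (its Jacobian rows are the `e_q`). -/
theorem coordSystem_reducedAt (A B : Vec n) : (coordSystem n).ReducedAt A B := by
  intro δ hδ
  funext q
  have hq := hδ (flat n q)
  simpa [coordSystem, coordTest, AffTest.jac, AffTest.coef] using hq

/-- **Tightness:** `n²` affine tests suffice, so `AffSystem.Correct.sq_le_m` is sharp. -/
theorem coordSystem_tight : (coordSystem n).Correct ∧ (coordSystem n).m = n * n :=
  ⟨coordSystem_correct, rfl⟩

end Summit.MatrixMultiplication.MatrixMultiplication.Theorems.GraphEquations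

end
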